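import Literature.AlgebraicGeometry.Resolution.BlowupRegularPairCharts
import Literature.AlgebraicGeometry.Resolution.BlowupAlgebraDerivations
import Literature.AlgebraicGeometry.Resolution.BlowupLiftsCongruence
import HarnessLib

/-!
# The ratios `π^*v / π^*u` on the principal charts of a blowing up (Stacks 0804, the gluing data)

Topic: `Literature/AlgebraicGeometry/Resolution`. Theorem-only file (no definition, no named fact).
Let `π : X' → X` be a blowing up along an ideal sheaf `I` (universal property, `IsBlowup π I`),
`W ⊆ X` an affine open and `u, v, w ∈ I(W)`. On the principal chart `X'[W, u]`
(`BlowupPrincipalCharts.lean`: affine, `π^*u` a regular generator of `I·𝒪_{X'}`) there is a unique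
regular function `T_{uv}` with `π^*v = π^*u · T_{uv}` — the element `v/u` of the affine blowup algebra
`A[I(W)/u]` (Stacks, Tag 0804: `b⁻¹(U)` is glued from the `Spec A[I/a]` along `D(b/a) = D(a/b)`).
We record the gluing relations of these ratios, which are exactly the axioms of the tree's
`GeneratingSections` (Hartshorne II Thm. 7.1) for the sections `π^*u` of the invertible sheaf
`I·𝒪_{X'} = 𝒪_{X'}(1)`:

* (`IsBlowup.exists_ringEquiv_blowupChart` of `BlowupLiftsCongruence.lean` gives
  `Γ(X', X'[W, u]) ≅ A[I(W)/u]` over `A = Γ(X, W)` for any `u ∈ I(W)`);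
* `IsBlowup.exists_chartRatio`, `IsBlowup.chartRatio_unique`, `IsBlowup.chartRatio_self` — existence and
  uniqueness of `T_{uv}`, `T_{uu} = 1`;
* `ringEquiv_chartRatio` — under any `A`-isomorphism `Γ(X', X'[W, u]) ≅ A[I(W)/u]`, `T_{uv} ↦ v/u`;
* `IsBlowup.basicOpen_chartRatio` — **`D(T_{uv}) = X'[W, u] ∩ X'[W, v]`**;
* `IsBlowup.chartRatio_mul_chartRatio` — **the cocycle rule `T_{uv} · T_{vw} = T_{uw}` on
  `X'[W, u] ∩ X'[W, v]`**.

## References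

* [StacksProject] The Stacks Project, Tag 0804 (Lemma 31.32.2) and Tag 052Q.
* [GortzWedhorn2020] U. Görtz, T. Wedhorn, Algebraic Geometry I, 2nd ed. (2020), (13.19) p. 415.
* [Hartshorne1977] R. Hartshorne, Algebraic Geometry (1977), II §7, proof of Prop. 7.10 (b).
-/

noncomputable section

open CategoryTheory CategoryTheory.Limits AlgebraicGeometry TopologicalSpace Opposite

namespace Literature.AlgebraicGeometry.Resolution

universe u

variable {X' X : Scheme.{u}} {π : X' ⟶ X} {I : X.IdealSheafData}

/-! ## The ratios `T_{uv} = π^*v / π^*u` -/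

section Ratio

variable (hπ : IsBlowup π I) (W : X.affineOpens) {u v w : Γ(X, W)}

/-- Notation-free abbreviation used in the statements below: the pull-back `π^*s ∈ Γ(X', X'[W, u])`. -/
local notation3 "pb" u ", " s => Scheme.Hom.appLE π (W : X.Opens) (blowupChart π I W u)
  (blowupChart_le_preimage π I W u) s

include hπ in
/-- **Existence of the ratio**: for `u, v ∈ I(W)` there is `T ∈ Γ(X', X'[W, u])` with `π^*v = π^*u · T`
(`π^*u` generates `I·𝒪_{X'} ∋ π^*v` on the chart). [cite: StacksProject, Tag 0804] -/
theorem IsBlowup.exists_chartRatio (hu : u ∈ I.ideal W) (hv : v ∈ I.ideal W) :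
    ∃ T : Γ(X', blowupChart π I W u), (pb u, v) = (pb u, u) * T := by
  obtain ⟨c, hc⟩ := (hπ.isPrincipalChart_blowupChart hu).exists_eq_mul hv
  exact ⟨c, hc.trans (mul_comm _ _)⟩

include hπ in
/-- **Uniqueness of the ratio** (`π^*u` is a nonzerodivisor on `X'[W, u]`). [cite: StacksProject, Tag 0804] -/
theorem IsBlowup.chartRatio_unique (hu : u ∈ I.ideal W) {T T' : Γ(X', blowupChart π I W u)}
    (hT : (pb u, v) = (pb u, u) * T) (hT' : (pb u, v) = (pb u, u) * T') : T = T' := by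
  obtain ⟨h₀, hnzd, -⟩ := hπ.isPrincipalChart_blowupChart hu
  rw [hT] at hT'
  exact (mul_cancel_left_mem_nonZeroDivisors hnzd).mp hT'

include hπ in
/-- `T_{uu} = 1`. [folklore] -/
theorem IsBlowup.chartRatio_self (hu : u ∈ I.ideal W) {T : Γ(X', blowupChart π I W u)}
    (hT : (pb u, u) = (pb u, u) * T) : T = 1 :=
  hπ.chartRatio_unique W hu hT (mul_one _).symm

/-- **Under `Γ(X', X'[W, u]) ≅ A[I(W)/u]` the ratio `T_{uv}` is `v/u`** (`u/1` is a nonzerodivisor of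
`A[I(W)/u]`). [cite: StacksProject, Tag 0804] -/
theorem ringEquiv_chartRatio (hv : v ∈ I.ideal W)
    (e : Γ(X', blowupChart π I W u) ≃+* blowupAlgebra (I.ideal W) u)
    (he : ∀ s, e (pb u, s) = algebraMap Γ(X, W) (blowupAlgebra (I.ideal W) u) s)
    {T : Γ(X', blowupChart π I W u)} (hT : (pb u, v) = (pb u, u) * T) :
    e T = blowupAlgebra.gen (I.ideal W) u v hv := by
  have h1 : algebraMap Γ(X, W) (blowupAlgebra (I.ideal W) u) v =
      algebraMap Γ(X, W) (blowupAlgebra (I.ideal W) u) u * e T := by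
    rw [← he v, hT, map_mul, he u]
  have h2 : algebraMap Γ(X, W) (blowupAlgebra (I.ideal W) u) u * blowupAlgebra.gen (I.ideal W) u v hv =
      algebraMap Γ(X, W) (blowupAlgebra (I.ideal W) u) u * e T :=
    (blowupAlgebra.algebraMap_mul_gen (I.ideal W) u v hv).trans h1
  exact ((mul_cancel_left_mem_nonZeroDivisors
    (algebraMap_mem_nonZeroDivisors_blowupAlgebra (I := I.ideal W) (a := u))).mp h2).symm

include hπ in
/-- **`D(T_{uv}) = X'[W, u] ∩ X'[W, v]`**: on `D(T_{uv})` the section `π^*v = π^*u · T_{uv}` is again a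
regular generator, so `D(T_{uv}) ⊆ X'[W, v]` (`basicOpen_le_blowupChart_pair`); conversely, near a point
of both charts `π^*u = c · π^*v = c · T_{uv} · π^*u` with `π^*u` regular, so `c · T_{uv} = 1`.
[cite: StacksProject, Tag 0804] -/
theorem IsBlowup.basicOpen_chartRatio (hu : u ∈ I.ideal W) (hv : v ∈ I.ideal W)
    {T : Γ(X', blowupChart π I W u)} (hT : (pb u, v) = (pb u, u) * T) :
    X'.basicOpen T = blowupChart π I W u ⊓ blowupChart π I W v := by
  apply le_antisymm
  · exact le_inf (X'.basicOpen_le T) (hπ.basicOpen_le_blowupChart_pair W hu hT)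
  · intro y hy
    -- a principal chart `W₁ ∋ y` for `u` inside `X'[W, v]`
    obtain ⟨W₁, hW₁, hyW₁, hW₁v⟩ := exists_isPrincipalChart_le_of_mem hy.1 hy.2
    have hW₁u : (W₁ : X'.Opens) ≤ blowupChart π I W u := hW₁.le_blowupChart
    obtain ⟨h₁, hnzd, -⟩ := id hW₁
    -- `W₁` is a principal chart for `v` too: `π^*u = c · π^*v` on it
    have hPv : IsPrincipalChart π I W v W₁ := (hπ.isPrincipalChart_blowupChart hv).of_le hW₁v
    obtain ⟨c, hc⟩ := hPv.exists_eq_mul hu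
    -- restrict `π^*v = π^*u · T` to `W₁`
    have hT₁ : π.appLE W W₁ h₁ v = π.appLE W W₁ h₁ u * X'.presheaf.map (homOfLE hW₁u).op T := by
      rw [← map_appLE_eq (blowupChart_le_preimage π I W u) hW₁u v, hT, map_mul,
        map_appLE_eq (blowupChart_le_preimage π I W u) hW₁u u]
    -- so `π^*u · (1 - c · T|) = 0`, hence `c · T| = 1`
    have hunit : IsUnit (X'.presheaf.map (homOfLE hW₁u).op T) := by
      have h0 : π.appLE W W₁ h₁ u * (1 - c * X'.presheaf.map (homOfLE hW₁u).op T) = 0 := by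
        have := hc
        rw [hT₁] at this
        linear_combination this
      have h1 : (1 : Γ(X', W₁)) - c * X'.presheaf.map (homOfLE hW₁u).op T = 0 :=
        (mul_cancel_left_mem_nonZeroDivisors hnzd).mp (h0.trans (mul_zero _).symm)
      exact IsUnit.of_mul_eq_one_right c (by linear_combination -h1)
    have hW₁eq : X'.basicOpen (X'.presheaf.map (homOfLE hW₁u).op T) = (W₁ : X'.Opens) :=
      X'.basicOpen_of_isUnit hunit
    have hy' : y ∈ X'.basicOpen (X'.presheaf.map (homOfLE hW₁u).op T) := by
      rw [hW₁eq]; exact hyW₁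
    rw [Scheme.basicOpen_res] at hy'
    exact hy'.2

include hπ in
/-- **The cocycle rule `T_{uv} · T_{vw} = T_{uw}` on `X'[W, u] ∩ X'[W, v]`** (the overlap is the affine
`D(T_{uv})`, a principal chart for `u`, and `π^*u · T_{uv} · T_{vw} = π^*v · T_{vw} = π^*w = π^*u · T_{uw}`
with `π^*u` a nonzerodivisor there). [cite: StacksProject, Tag 0804] -/
theorem IsBlowup.chartRatio_mul_chartRatio (hu : u ∈ I.ideal W) (hv : v ∈ I.ideal W)
    {Tuv : Γ(X', blowupChart π I W u)} (hTuv : (pb u, v) = (pb u, u) * Tuv)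
    {Tvw : Γ(X', blowupChart π I W v)} (hTvw : (pb v, w) = (pb v, v) * Tvw)
    {Tuw : Γ(X', blowupChart π I W u)} (hTuw : (pb u, w) = (pb u, u) * Tuw) :
    X'.presheaf.map (homOfLE (inf_le_left : blowupChart π I W u ⊓ blowupChart π I W v ≤ _)).op Tuv *
        X'.presheaf.map (homOfLE (inf_le_right : blowupChart π I W u ⊓ blowupChart π I W v ≤ _)).op Tvw =
      X'.presheaf.map (homOfLE (inf_le_left : blowupChart π I W u ⊓ blowupChart π I W v ≤ _)).op Tuw := by
  set O : X'.Opens := blowupChart π I W u ⊓ blowupChart π I W v with hO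
  have hOu : O ≤ blowupChart π I W u := inf_le_left
  have hOv : O ≤ blowupChart π I W v := inf_le_right
  -- `O = D(T_{uv})` is affine and a principal chart for `u`
  have hOeq : X'.basicOpen Tuv = O := hπ.basicOpen_chartRatio W hu hv hTuv
  have hOaff : IsAffineOpen O := hOeq ▸ (hπ.isAffineOpen_blowupChart hu).basicOpen Tuv
  have hPO : IsPrincipalChart π I W u ⟨O, hOaff⟩ := (hπ.isPrincipalChart_blowupChart hu).of_le hOu
  obtain ⟨hO₁, hnzd, -⟩ := hPO
  -- restrict the three defining equations to `O`
  have e1 : π.appLE W O hO₁ v = π.appLE W O hO₁ u * X'.presheaf.map (homOfLE hOu).op Tuv := by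
    rw [← map_appLE_eq (blowupChart_le_preimage π I W u) hOu v, hTuv, map_mul,
      map_appLE_eq (blowupChart_le_preimage π I W u) hOu u]
  have e2 : π.appLE W O hO₁ w = π.appLE W O hO₁ v * X'.presheaf.map (homOfLE hOv).op Tvw := by
    rw [← map_appLE_eq (blowupChart_le_preimage π I W v) hOv w, hTvw, map_mul,
      map_appLE_eq (blowupChart_le_preimage π I W v) hOv v]
  have e3 : π.appLE W O hO₁ w = π.appLE W O hO₁ u * X'.presheaf.map (homOfLE hOu).op Tuw := by
    rw [← map_appLE_eq (blowupChart_le_preimage π I W u) hOu w, hTuw, map_mul,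
      map_appLE_eq (blowupChart_le_preimage π I W u) hOu u]
  have h : π.appLE W O hO₁ u *
      (X'.presheaf.map (homOfLE hOu).op Tuv * X'.presheaf.map (homOfLE hOv).op Tvw) =
      π.appLE W O hO₁ u * X'.presheaf.map (homOfLE hOu).op Tuw := by
    rw [← mul_assoc, ← e1, ← e2, e3]
  exact (mul_cancel_left_mem_nonZeroDivisors hnzd).mp h

end Ratio

end Literature.AlgebraicGeometry.Resolution

end
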